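import Mathlib
import Literature.Analysis.FluidPDE.VectorCalculus

/-!
# Transverse linearisation block of the filament skeleton, off-diagonal entries
(stub `stub_strainBlockOffDiagA1`, line `Sketch`)

Helper file (theorems only) for the crux `FilamentSkeletonRss.SkeletonEquilibrium`
(stmt-NavierStokesRegularity-15400), line `Sketch`, re-keyed datum `α = −1`:
`P₀ = (1, 0, −10)`, `e₀ = (0, 4/5, 3/5)`, `γ/2π = 8`. In the rotating Leray frame the rescaled
skeleton field of the datum is
`F y = ½ y − α e₃ × y + Σ_{k=1,2,3} 8 (‖y − P_k‖² − ⟪y − P_k, e_k⟫²)⁻¹ · e_k × (y − P_k)`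
(drift plus straight-line Biot–Savart induction of the three image lines `P_k + ℝ e_k`,
`P₁ = (0, 1, −10)`, `e₁ = (−4/5, 0, 3/5)`, `P₂ = (−1, 0, −10)`, `e₂ = (0, −4/5, 3/5)`,
`P₃ = (0, −1, −10)`, `e₃' = (4/5, 0, 3/5)`). Along the core line `x = P₀ + t e₀`, in the unit
transverse basis `n₁ = (1, 0, 0)`, `n₂ = e₀ × n₁ = (0, 3/5, −4/5)`, the two OFF-DIAGONAL entries of
the transverse linearisation, `Q₁₂(t) = d/ds ⟪F(x + s n₁), n₂⟫|₀` and
`Q₂₁(t) = d/ds ⟪F(x + s n₂), n₁⟫|₀ = Q₁₂(t) − 6/5`, are the stated closed forms.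

Proof (1-D, no `fderiv`; K2-shaped, adapted from the sibling crux's
`FilamentSkeletonRssCoreGluingSiblingDatumStrainModel` with the probing direction `v` and the
component `w` decoupled): `g(s) = ⟪F(x + s v), w⟫ = ½⟪x, w⟫ + ½ s ⟪v, w⟫ − α⟪n × x, w⟫
− α s ⟪n × v, w⟫ + Σ_k q (c_k + s κ_k) / D_k(s)`, where now the Biot–Savart numerator
`⟪e_k × (x + s v − P_k), w⟫ = c_k + s κ_k`, `κ_k = ⟪e_k × v, w⟫`, is AFFINE in `s`
(`sbo_cross_term_affine`) and `D_k(s) = D_k + 2 β_k s + γ_k s²` (`sbo_denom_quadratic`). Hence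
`g′(0) = ½⟪v, w⟫ − α⟪n × v, w⟫ + Σ_k q (κ_k / D_k − 2 β_k c_k / D_k²)` (`sbo_hasDerivAt_link`);
reading off `D_k, β_k, c_k, κ_k` in coordinates (`sbo_datum_*`; here `⟪v, w⟫ = 0` and
`−α⟪e₃ × v, w⟫ = ± 3/5`) and clearing the three positive denominators
`D₁ = 2(272t² − 320t + 425)/625`, `D₂ = 4(144t² + 625)/625`, `D₃ = 2(272t² + 320t + 425)/625`
gives the closed forms by `field_simp; ring`.
-/

namespace Summit.NavierStokesRegularity.NavierStokesRegularity.Theorems.SkeletonEquilibrium.Sketch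
set_option linter.dupNamespace false

noncomputable section

open Literature.Analysis.FluidPDE

/-! ### Coordinates on `ℝ³` -/

/-- Coordinates of the inner product on `ℝ³`. [folklore] -/
private theorem sbo_inner_three (a b : EuclideanSpace ℝ (Fin 3)) :
    inner ℝ a b = a 0 * b 0 + a 1 * b 1 + a 2 * b 2 := by
  simp [PiLp.inner_apply, Fin.sum_univ_three, mul_comm]

/-- `‖a‖² = Σ aᵢ²` on `ℝ³`. [folklore] -/
private theorem sbo_norm_sq_three (a : EuclideanSpace ℝ (Fin 3)) :
    ‖a‖ ^ 2 = a 0 ^ 2 + a 1 ^ 2 + a 2 ^ 2 := by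
  rw [EuclideanSpace.real_norm_sq_eq, Fin.sum_univ_three]

/-- Coordinates of the triple product `⟨a × b, c⟩` on `ℝ³`. [folklore] -/
private theorem sbo_inner_cross_three (a b c : EuclideanSpace ℝ (Fin 3)) :
    inner ℝ (cross a b) c = (a 1 * b 2 - a 2 * b 1) * c 0 + (a 2 * b 0 - a 0 * b 2) * c 1
      + (a 0 * b 1 - a 1 * b 0) * c 2 := by
  rw [sbo_inner_three]
  simp [cross, cross_apply]

/-! ### The abstract 1-D link (probing direction `v`, component `w`) -/

/-- `⟨x + s v, w⟩ = ⟨x, w⟩ + s ⟨v, w⟩`. [folklore] -/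
private theorem sbo_inner_shift (x v w : EuclideanSpace ℝ (Fin 3)) (s : ℝ) :
    inner ℝ (x + s • v) w = inner ℝ x w + s * inner ℝ v w := by
  rw [inner_add_left, real_inner_smul_left]

/-- `⟨n × (x + s v), w⟩ = ⟨n × x, w⟩ + s ⟨n × v, w⟩`. [folklore] -/
private theorem sbo_cross_shift (n x v w : EuclideanSpace ℝ (Fin 3)) (s : ℝ) :
    inner ℝ (cross n (x + s • v)) w = inner ℝ (cross n x) w + s * inner ℝ (cross n v) w := by
  rw [sbo_inner_cross_three, sbo_inner_cross_three, sbo_inner_cross_three]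
  simp only [PiLp.add_apply, PiLp.smul_apply, smul_eq_mul]
  ring

/-- `⟨e × (x + s v − P), w⟩ = ⟨e × (x − P), w⟩ + s ⟨e × v, w⟩`: the Biot–Savart numerator is affine
along the probing line. [folklore] -/
private theorem sbo_cross_term_affine (e x v P w : EuclideanSpace ℝ (Fin 3)) (s : ℝ) :
    inner ℝ (cross e (x + s • v - P)) w
      = inner ℝ (cross e (x - P)) w + s * inner ℝ (cross e v) w := by
  rw [sbo_inner_cross_three, sbo_inner_cross_three, sbo_inner_cross_three]
  simp only [PiLp.add_apply, PiLp.sub_apply, PiLp.smul_apply, smul_eq_mul]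
  ring

/-- The squared distance to a line, `‖y − P‖² − ⟨y − P, e⟩²`, restricted to the probing line
`y = x + s v`, is the quadratic `D + 2βs + γs²`. [folklore] -/
private theorem sbo_denom_quadratic (x v P e : EuclideanSpace ℝ (Fin 3)) (s : ℝ) :
    ‖x + s • v - P‖ ^ 2 - (inner ℝ (x + s • v - P) e) ^ 2 =
      (‖x - P‖ ^ 2 - (inner ℝ (x - P) e) ^ 2)
        + 2 * (inner ℝ (x - P) v - inner ℝ (x - P) e * inner ℝ v e) * s
        + (‖v‖ ^ 2 - (inner ℝ v e) ^ 2) * s ^ 2 := by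
  simp only [sbo_norm_sq_three, sbo_inner_three, PiLp.add_apply, PiLp.sub_apply,
    PiLp.smul_apply, smul_eq_mul]
  ring

/-- Linearity of `⟨·, w⟩` on the five summands of the model field. [folklore] -/
private theorem sbo_inner_model_expand (y w₀ w₁ w₂ w₃ w : EuclideanSpace ℝ (Fin 3))
    (h α r₁ r₂ r₃ : ℝ) :
    inner ℝ (h • y - α • w₀ + r₁ • w₁ + r₂ • w₂ + r₃ • w₃) w
      = h * inner ℝ y w - α * inner ℝ w₀ w + r₁ * inner ℝ w₁ w + r₂ * inner ℝ w₂ w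
        + r₃ * inner ℝ w₃ w := by
  simp only [inner_add_left, inner_sub_left, real_inner_smul_left]

/-- One weighted Lorentzian with affine numerator along the probing line:
`d/ds [q (c + κ s) / (D + 2βs + γs²)]|₀ = qκ/D − 2qβc/D²`. [folklore] -/
private theorem sbo_hasDerivAt_lorentz (q D β γ c κ : ℝ) (hD : D ≠ 0) :
    HasDerivAt (fun s : ℝ => q / (D + 2 * β * s + γ * s ^ 2) * (c + s * κ))
      (q * κ / D - q * c * (2 * β) / D ^ 2) 0 := by
  have hq : HasDerivAt (fun s : ℝ => D + 2 * β * s + γ * s ^ 2) (2 * β) 0 := by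
    have h1 : HasDerivAt (fun s : ℝ => 2 * β * s) (2 * β) 0 := by
      simpa using (hasDerivAt_id (0 : ℝ)).const_mul (2 * β)
    have h2 : HasDerivAt (fun s : ℝ => γ * s ^ 2) 0 0 := by
      simpa using (hasDerivAt_pow 2 (0 : ℝ)).const_mul γ
    simpa using (h1.const_add D).fun_add h2
  have hn : HasDerivAt (fun s : ℝ => c + s * κ) κ 0 := by
    simpa using ((hasDerivAt_id (0 : ℝ)).mul_const κ).const_add c
  have h := ((hasDerivAt_const (0 : ℝ) q).fun_div hq (by simpa using hD)).fun_mul hn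
  refine h.congr_deriv ?_
  simp only [mul_zero, add_zero, zero_mul, ne_eq, OfNat.ofNat_ne_zero, not_false_eq_true,
    zero_pow, zero_sub]
  ring

/-- The scalar model `½(K + sL) − α(M + sN) + Σ_k q (c_k + κ_k s)/(D_k + 2β_k s + γ_k s²)` along the
probing line has derivative `½ L − α N + Σ_k (q κ_k / D_k − 2 q β_k c_k / D_k²)` at `s = 0`.
[folklore] -/
private theorem sbo_hasDerivAt_scalar
    (q α K L M N D₁ β₁ γ₁ c₁ κ₁ D₂ β₂ γ₂ c₂ κ₂ D₃ β₃ γ₃ c₃ κ₃ : ℝ)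
    (h₁ : D₁ ≠ 0) (h₂ : D₂ ≠ 0) (h₃ : D₃ ≠ 0) :
    HasDerivAt (fun s : ℝ => (1 / 2 : ℝ) * (K + s * L) - α * (M + s * N)
        + q / (D₁ + 2 * β₁ * s + γ₁ * s ^ 2) * (c₁ + s * κ₁)
        + q / (D₂ + 2 * β₂ * s + γ₂ * s ^ 2) * (c₂ + s * κ₂)
        + q / (D₃ + 2 * β₃ * s + γ₃ * s ^ 2) * (c₃ + s * κ₃))
      ((1 / 2 : ℝ) * L - α * N
        + (q * κ₁ / D₁ - q * c₁ * (2 * β₁) / D₁ ^ 2)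
        + (q * κ₂ / D₂ - q * c₂ * (2 * β₂) / D₂ ^ 2)
        + (q * κ₃ / D₃ - q * c₃ * (2 * β₃) / D₃ ^ 2)) 0 := by
  have ha : HasDerivAt (fun s : ℝ => (1 / 2 : ℝ) * (K + s * L)) ((1 / 2 : ℝ) * L) 0 := by
    simpa using (((hasDerivAt_id (0 : ℝ)).mul_const L).const_add K).const_mul (1 / 2 : ℝ)
  have hb : HasDerivAt (fun s : ℝ => α * (M + s * N)) (α * N) 0 := by
    simpa using (((hasDerivAt_id (0 : ℝ)).mul_const N).const_add M).const_mul α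
  have h0 : HasDerivAt (fun s : ℝ => (1 / 2 : ℝ) * (K + s * L) - α * (M + s * N))
      ((1 / 2 : ℝ) * L - α * N) 0 := ha.fun_sub hb
  exact (((h0.fun_add (sbo_hasDerivAt_lorentz q D₁ β₁ γ₁ c₁ κ₁ h₁)).fun_add
    (sbo_hasDerivAt_lorentz q D₂ β₂ γ₂ c₂ κ₂ h₂)).fun_add
    (sbo_hasDerivAt_lorentz q D₃ β₃ γ₃ c₃ κ₃ h₃)).congr_deriv (by ring)

/-- **Abstract 1-D link (decoupled directions).** For the model field
`F y = ½ y − α n × y + Σ_k q (‖y − P_k‖² − ⟪y − P_k, e_k⟫²)⁻¹ · e_k × (y − P_k)` and any point `x`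
off the three lines, `s ↦ ⟪F(x + s v), w⟫` has derivative
`½⟪v, w⟫ − α⟪n × v, w⟫ + Σ_k (q κ_k / D_k − q c_k · 2β_k / D_k²)` at `s = 0`, where
`D_k = ‖x − P_k‖² − ⟪x − P_k, e_k⟫²`, `β_k = ⟪x − P_k, v⟫ − ⟪x − P_k, e_k⟫⟪v, e_k⟫`,
`c_k = ⟪e_k × (x − P_k), w⟫`, `κ_k = ⟪e_k × v, w⟫`. [folklore] -/
private theorem sbo_hasDerivAt_link (x v w n P₁ e₁ P₂ e₂ P₃ e₃ : EuclideanSpace ℝ (Fin 3))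
    (α q : ℝ)
    (h₁ : ‖x - P₁‖ ^ 2 - (inner ℝ (x - P₁) e₁) ^ 2 ≠ 0)
    (h₂ : ‖x - P₂‖ ^ 2 - (inner ℝ (x - P₂) e₂) ^ 2 ≠ 0)
    (h₃ : ‖x - P₃‖ ^ 2 - (inner ℝ (x - P₃) e₃) ^ 2 ≠ 0) :
    HasDerivAt (fun s : ℝ => inner ℝ ((1 / 2 : ℝ) • (x + s • v) - α • cross n (x + s • v)
        + (q / (‖(x + s • v) - P₁‖ ^ 2 - (inner ℝ ((x + s • v) - P₁) e₁) ^ 2)) •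
            cross e₁ ((x + s • v) - P₁)
        + (q / (‖(x + s • v) - P₂‖ ^ 2 - (inner ℝ ((x + s • v) - P₂) e₂) ^ 2)) •
            cross e₂ ((x + s • v) - P₂)
        + (q / (‖(x + s • v) - P₃‖ ^ 2 - (inner ℝ ((x + s • v) - P₃) e₃) ^ 2)) •
            cross e₃ ((x + s • v) - P₃)) w)
      ((1 / 2 : ℝ) * inner ℝ v w - α * inner ℝ (cross n v) w
        + (q * inner ℝ (cross e₁ v) w / (‖x - P₁‖ ^ 2 - (inner ℝ (x - P₁) e₁) ^ 2)
            - q * inner ℝ (cross e₁ (x - P₁)) w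
              * (2 * (inner ℝ (x - P₁) v - inner ℝ (x - P₁) e₁ * inner ℝ v e₁))
              / (‖x - P₁‖ ^ 2 - (inner ℝ (x - P₁) e₁) ^ 2) ^ 2)
        + (q * inner ℝ (cross e₂ v) w / (‖x - P₂‖ ^ 2 - (inner ℝ (x - P₂) e₂) ^ 2)
            - q * inner ℝ (cross e₂ (x - P₂)) w
              * (2 * (inner ℝ (x - P₂) v - inner ℝ (x - P₂) e₂ * inner ℝ v e₂))
              / (‖x - P₂‖ ^ 2 - (inner ℝ (x - P₂) e₂) ^ 2) ^ 2)
        + (q * inner ℝ (cross e₃ v) w / (‖x - P₃‖ ^ 2 - (inner ℝ (x - P₃) e₃) ^ 2)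
            - q * inner ℝ (cross e₃ (x - P₃)) w
              * (2 * (inner ℝ (x - P₃) v - inner ℝ (x - P₃) e₃ * inner ℝ v e₃))
              / (‖x - P₃‖ ^ 2 - (inner ℝ (x - P₃) e₃) ^ 2) ^ 2)) 0 := by
  refine (sbo_hasDerivAt_scalar q α (inner ℝ x w) (inner ℝ v w) (inner ℝ (cross n x) w)
    (inner ℝ (cross n v) w)
    (‖x - P₁‖ ^ 2 - (inner ℝ (x - P₁) e₁) ^ 2)
    (inner ℝ (x - P₁) v - inner ℝ (x - P₁) e₁ * inner ℝ v e₁) (‖v‖ ^ 2 - (inner ℝ v e₁) ^ 2)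
    (inner ℝ (cross e₁ (x - P₁)) w) (inner ℝ (cross e₁ v) w)
    (‖x - P₂‖ ^ 2 - (inner ℝ (x - P₂) e₂) ^ 2)
    (inner ℝ (x - P₂) v - inner ℝ (x - P₂) e₂ * inner ℝ v e₂) (‖v‖ ^ 2 - (inner ℝ v e₂) ^ 2)
    (inner ℝ (cross e₂ (x - P₂)) w) (inner ℝ (cross e₂ v) w)
    (‖x - P₃‖ ^ 2 - (inner ℝ (x - P₃) e₃) ^ 2)
    (inner ℝ (x - P₃) v - inner ℝ (x - P₃) e₃ * inner ℝ v e₃) (‖v‖ ^ 2 - (inner ℝ v e₃) ^ 2)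
    (inner ℝ (cross e₃ (x - P₃)) w) (inner ℝ (cross e₃ v) w) h₁ h₂ h₃).congr_of_eventuallyEq
    (Filter.Eventually.of_forall fun s => ?_)
  beta_reduce
  rw [sbo_inner_model_expand, sbo_inner_shift, sbo_cross_shift,
    sbo_cross_term_affine, sbo_cross_term_affine, sbo_cross_term_affine,
    sbo_denom_quadratic, sbo_denom_quadratic, sbo_denom_quadratic]

/-! ### The datum in coordinates -/

/-- The three image lines seen from the core line `x = P₀ + t e₀`:
`D₁ = 2(272t² − 320t + 425)/625`, `D₂ = 4(144t² + 625)/625`, `D₃ = 2(272t² + 320t + 425)/625`.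
[folklore] -/
private theorem sbo_datum_denoms (t : ℝ) (x : EuclideanSpace ℝ (Fin 3))
    (hx : x = !₂[(1 : ℝ), (0 : ℝ), ((-10) : ℝ)] + t • !₂[(0 : ℝ), (4 / 5 : ℝ), (3 / 5 : ℝ)]) :
    ‖x - !₂[(0 : ℝ), (1 : ℝ), ((-10) : ℝ)]‖ ^ 2
        - (inner ℝ (x - !₂[(0 : ℝ), (1 : ℝ), ((-10) : ℝ)])
            !₂[(-(4 / 5 : ℝ)), (0 : ℝ), (3 / 5 : ℝ)]) ^ 2
          = 2 * (272 * t ^ 2 - 320 * t + 425) / 625 ∧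
      ‖x - !₂[((-1) : ℝ), (0 : ℝ), ((-10) : ℝ)]‖ ^ 2
        - (inner ℝ (x - !₂[((-1) : ℝ), (0 : ℝ), ((-10) : ℝ)])
            !₂[(0 : ℝ), (-(4 / 5 : ℝ)), (3 / 5 : ℝ)]) ^ 2
          = 4 * (144 * t ^ 2 + 625) / 625 ∧
      ‖x - !₂[(0 : ℝ), ((-1) : ℝ), ((-10) : ℝ)]‖ ^ 2
        - (inner ℝ (x - !₂[(0 : ℝ), ((-1) : ℝ), ((-10) : ℝ)])
            !₂[(4 / 5 : ℝ), (0 : ℝ), (3 / 5 : ℝ)]) ^ 2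
          = 2 * (272 * t ^ 2 + 320 * t + 425) / 625 := by
  subst hx
  simp only [sbo_norm_sq_three, sbo_inner_three]
  simp
  refine ⟨?_, ?_, ?_⟩ <;> ring

/-- Entry `(1,2)` (probe `v = n₁ = (1,0,0)`, component `w = n₂ = (0,3/5,−4/5)`), drift part:
`⟪v, w⟫ = 0`, `⟪e₃ × v, w⟫ = 3/5`. [folklore] -/
private theorem sbo_datum12_drift :
    inner ℝ (!₂[(1 : ℝ), (0 : ℝ), (0 : ℝ)] : EuclideanSpace ℝ (Fin 3))
        !₂[(0 : ℝ), (3 / 5 : ℝ), (-(4 / 5 : ℝ))] = 0 ∧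
      inner ℝ (cross (EuclideanSpace.single (2 : Fin 3) (1 : ℝ)) !₂[(1 : ℝ), (0 : ℝ), (0 : ℝ)])
        !₂[(0 : ℝ), (3 / 5 : ℝ), (-(4 / 5 : ℝ))] = 3 / 5 := by
  rw [sbo_inner_cross_three, sbo_inner_three]
  simp

/-- Entry `(1,2)`, image lines: `β₁ = 36t/125 + 9/25`, `c₁ = 4t/5 − 7/25`, `κ₁ = 9/25`;
`β₂ = 2`, `c₂ = −14/25`, `κ₂ = −7/25`; `β₃ = −36t/125 + 9/25`, `c₃ = −4t/5 − 7/25`, `κ₃ = 9/25`.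
[folklore] -/
private theorem sbo_datum12_lines (t : ℝ) (x : EuclideanSpace ℝ (Fin 3))
    (hx : x = !₂[(1 : ℝ), (0 : ℝ), ((-10) : ℝ)] + t • !₂[(0 : ℝ), (4 / 5 : ℝ), (3 / 5 : ℝ)]) :
    (inner ℝ (x - !₂[(0 : ℝ), (1 : ℝ), ((-10) : ℝ)]) !₂[(1 : ℝ), (0 : ℝ), (0 : ℝ)]
        - inner ℝ (x - !₂[(0 : ℝ), (1 : ℝ), ((-10) : ℝ)]) !₂[(-(4 / 5 : ℝ)), (0 : ℝ), (3 / 5 : ℝ)]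
          * inner ℝ (!₂[(1 : ℝ), (0 : ℝ), (0 : ℝ)] : EuclideanSpace ℝ (Fin 3))
              !₂[(-(4 / 5 : ℝ)), (0 : ℝ), (3 / 5 : ℝ)]
          = 36 / 125 * t + 9 / 25 ∧
      inner ℝ (cross !₂[(-(4 / 5 : ℝ)), (0 : ℝ), (3 / 5 : ℝ)]
          (x - !₂[(0 : ℝ), (1 : ℝ), ((-10) : ℝ)]))
          !₂[(0 : ℝ), (3 / 5 : ℝ), (-(4 / 5 : ℝ))] = 4 / 5 * t - 7 / 25 ∧
      inner ℝ (cross !₂[(-(4 / 5 : ℝ)), (0 : ℝ), (3 / 5 : ℝ)] !₂[(1 : ℝ), (0 : ℝ), (0 : ℝ)])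
          !₂[(0 : ℝ), (3 / 5 : ℝ), (-(4 / 5 : ℝ))] = 9 / 25) ∧
    (inner ℝ (x - !₂[((-1) : ℝ), (0 : ℝ), ((-10) : ℝ)]) !₂[(1 : ℝ), (0 : ℝ), (0 : ℝ)]
        - inner ℝ (x - !₂[((-1) : ℝ), (0 : ℝ), ((-10) : ℝ)])
            !₂[(0 : ℝ), (-(4 / 5 : ℝ)), (3 / 5 : ℝ)]
          * inner ℝ (!₂[(1 : ℝ), (0 : ℝ), (0 : ℝ)] : EuclideanSpace ℝ (Fin 3))
              !₂[(0 : ℝ), (-(4 / 5 : ℝ)), (3 / 5 : ℝ)]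
          = 2 ∧
      inner ℝ (cross !₂[(0 : ℝ), (-(4 / 5 : ℝ)), (3 / 5 : ℝ)]
          (x - !₂[((-1) : ℝ), (0 : ℝ), ((-10) : ℝ)]))
          !₂[(0 : ℝ), (3 / 5 : ℝ), (-(4 / 5 : ℝ))] = -(14 / 25) ∧
      inner ℝ (cross !₂[(0 : ℝ), (-(4 / 5 : ℝ)), (3 / 5 : ℝ)] !₂[(1 : ℝ), (0 : ℝ), (0 : ℝ)])
          !₂[(0 : ℝ), (3 / 5 : ℝ), (-(4 / 5 : ℝ))] = -(7 / 25)) ∧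
    (inner ℝ (x - !₂[(0 : ℝ), ((-1) : ℝ), ((-10) : ℝ)]) !₂[(1 : ℝ), (0 : ℝ), (0 : ℝ)]
        - inner ℝ (x - !₂[(0 : ℝ), ((-1) : ℝ), ((-10) : ℝ)]) !₂[(4 / 5 : ℝ), (0 : ℝ), (3 / 5 : ℝ)]
          * inner ℝ (!₂[(1 : ℝ), (0 : ℝ), (0 : ℝ)] : EuclideanSpace ℝ (Fin 3))
              !₂[(4 / 5 : ℝ), (0 : ℝ), (3 / 5 : ℝ)]
          = -(36 / 125) * t + 9 / 25 ∧
      inner ℝ (cross !₂[(4 / 5 : ℝ), (0 : ℝ), (3 / 5 : ℝ)]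
          (x - !₂[(0 : ℝ), ((-1) : ℝ), ((-10) : ℝ)]))
          !₂[(0 : ℝ), (3 / 5 : ℝ), (-(4 / 5 : ℝ))] = -(4 / 5) * t - 7 / 25 ∧
      inner ℝ (cross !₂[(4 / 5 : ℝ), (0 : ℝ), (3 / 5 : ℝ)] !₂[(1 : ℝ), (0 : ℝ), (0 : ℝ)])
          !₂[(0 : ℝ), (3 / 5 : ℝ), (-(4 / 5 : ℝ))] = 9 / 25) := by
  subst hx
  simp only [sbo_inner_cross_three]
  simp only [sbo_inner_three]
  simp
  refine ⟨⟨?_, ?_, ?_⟩, ⟨?_, ?_, ?_⟩, ?_, ?_, ?_⟩ <;> ring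

/-- Entry `(2,1)` (probe `v = n₂ = (0,3/5,−4/5)`, component `w = n₁ = (1,0,0)`), drift part:
`⟪v, w⟫ = 0`, `⟪e₃ × v, w⟫ = −3/5`. [folklore] -/
private theorem sbo_datum21_drift :
    inner ℝ (!₂[(0 : ℝ), (3 / 5 : ℝ), (-(4 / 5 : ℝ))] : EuclideanSpace ℝ (Fin 3))
        !₂[(1 : ℝ), (0 : ℝ), (0 : ℝ)] = 0 ∧
      inner ℝ (cross (EuclideanSpace.single (2 : Fin 3) (1 : ℝ))
          !₂[(0 : ℝ), (3 / 5 : ℝ), (-(4 / 5 : ℝ))]) !₂[(1 : ℝ), (0 : ℝ), (0 : ℝ)] = -(3 / 5) := by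
  rw [sbo_inner_cross_three, sbo_inner_three]
  simp

/-- Entry `(2,1)`, image lines: `β₁ = 108t/625 − 123/125`, `c₁ = −12t/25 + 3/5`, `κ₁ = −9/25`;
`β₂ = −168t/625`, `c₂ = −24t/25`, `κ₂ = 7/25`; `β₃ = 108t/625 + 123/125`, `c₃ = −12t/25 − 3/5`,
`κ₃ = −9/25`. [folklore] -/
private theorem sbo_datum21_lines (t : ℝ) (x : EuclideanSpace ℝ (Fin 3))
    (hx : x = !₂[(1 : ℝ), (0 : ℝ), ((-10) : ℝ)] + t • !₂[(0 : ℝ), (4 / 5 : ℝ), (3 / 5 : ℝ)]) :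
    (inner ℝ (x - !₂[(0 : ℝ), (1 : ℝ), ((-10) : ℝ)]) !₂[(0 : ℝ), (3 / 5 : ℝ), (-(4 / 5 : ℝ))]
        - inner ℝ (x - !₂[(0 : ℝ), (1 : ℝ), ((-10) : ℝ)]) !₂[(-(4 / 5 : ℝ)), (0 : ℝ), (3 / 5 : ℝ)]
          * inner ℝ (!₂[(0 : ℝ), (3 / 5 : ℝ), (-(4 / 5 : ℝ))] : EuclideanSpace ℝ (Fin 3))
              !₂[(-(4 / 5 : ℝ)), (0 : ℝ), (3 / 5 : ℝ)]
          = 108 / 625 * t - 123 / 125 ∧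
      inner ℝ (cross !₂[(-(4 / 5 : ℝ)), (0 : ℝ), (3 / 5 : ℝ)]
          (x - !₂[(0 : ℝ), (1 : ℝ), ((-10) : ℝ)]))
          !₂[(1 : ℝ), (0 : ℝ), (0 : ℝ)] = -(12 / 25) * t + 3 / 5 ∧
      inner ℝ (cross !₂[(-(4 / 5 : ℝ)), (0 : ℝ), (3 / 5 : ℝ)]
          !₂[(0 : ℝ), (3 / 5 : ℝ), (-(4 / 5 : ℝ))]) !₂[(1 : ℝ), (0 : ℝ), (0 : ℝ)] = -(9 / 25)) ∧
    (inner ℝ (x - !₂[((-1) : ℝ), (0 : ℝ), ((-10) : ℝ)]) !₂[(0 : ℝ), (3 / 5 : ℝ), (-(4 / 5 : ℝ))]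
        - inner ℝ (x - !₂[((-1) : ℝ), (0 : ℝ), ((-10) : ℝ)])
            !₂[(0 : ℝ), (-(4 / 5 : ℝ)), (3 / 5 : ℝ)]
          * inner ℝ (!₂[(0 : ℝ), (3 / 5 : ℝ), (-(4 / 5 : ℝ))] : EuclideanSpace ℝ (Fin 3))
              !₂[(0 : ℝ), (-(4 / 5 : ℝ)), (3 / 5 : ℝ)]
          = -(168 / 625) * t ∧
      inner ℝ (cross !₂[(0 : ℝ), (-(4 / 5 : ℝ)), (3 / 5 : ℝ)]
          (x - !₂[((-1) : ℝ), (0 : ℝ), ((-10) : ℝ)]))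
          !₂[(1 : ℝ), (0 : ℝ), (0 : ℝ)] = -(24 / 25) * t ∧
      inner ℝ (cross !₂[(0 : ℝ), (-(4 / 5 : ℝ)), (3 / 5 : ℝ)]
          !₂[(0 : ℝ), (3 / 5 : ℝ), (-(4 / 5 : ℝ))]) !₂[(1 : ℝ), (0 : ℝ), (0 : ℝ)] = 7 / 25) ∧
    (inner ℝ (x - !₂[(0 : ℝ), ((-1) : ℝ), ((-10) : ℝ)]) !₂[(0 : ℝ), (3 / 5 : ℝ), (-(4 / 5 : ℝ))]
        - inner ℝ (x - !₂[(0 : ℝ), ((-1) : ℝ), ((-10) : ℝ)]) !₂[(4 / 5 : ℝ), (0 : ℝ), (3 / 5 : ℝ)]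
          * inner ℝ (!₂[(0 : ℝ), (3 / 5 : ℝ), (-(4 / 5 : ℝ))] : EuclideanSpace ℝ (Fin 3))
              !₂[(4 / 5 : ℝ), (0 : ℝ), (3 / 5 : ℝ)]
          = 108 / 625 * t + 123 / 125 ∧
      inner ℝ (cross !₂[(4 / 5 : ℝ), (0 : ℝ), (3 / 5 : ℝ)]
          (x - !₂[(0 : ℝ), ((-1) : ℝ), ((-10) : ℝ)]))
          !₂[(1 : ℝ), (0 : ℝ), (0 : ℝ)] = -(12 / 25) * t - 3 / 5 ∧
      inner ℝ (cross !₂[(4 / 5 : ℝ), (0 : ℝ), (3 / 5 : ℝ)]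
          !₂[(0 : ℝ), (3 / 5 : ℝ), (-(4 / 5 : ℝ))]) !₂[(1 : ℝ), (0 : ℝ), (0 : ℝ)] = -(9 / 25)) := by
  subst hx
  simp only [sbo_inner_cross_three]
  simp only [sbo_inner_three]
  simp
  refine ⟨⟨?_, ?_, ?_⟩, ⟨?_, ?_, ?_⟩, ?_, ?_, ?_⟩ <;> ring

/-- The three cleared denominators are positive. [folklore] -/
private theorem sbo_denoms_pos (t : ℝ) :
    0 < 272 * t ^ 2 - 320 * t + 425 ∧ 0 < 144 * t ^ 2 + 625 ∧ 0 < 272 * t ^ 2 + 320 * t + 425 := by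
  refine ⟨by nlinarith [sq_nonneg (17 * t - 10)], by positivity,
    by nlinarith [sq_nonneg (17 * t + 10)]⟩

/-! ### The stub -/

/-- Entry `(1,2)` of the transverse linearisation block: probe `n₁`, component `n₂`. [folklore] -/
private theorem sbo_entry12 : ∀ (Q : ℝ → ℝ), (∀ t, Q t = 3 / 5 + (-(115200 : ℝ) * t ^ 2 - 612000 * t + 540000) / (272 * t ^ 2 - 320 * t + 425) ^ 2 + ((218750 : ℝ) - 50400 * t ^ 2) / (144 * t ^ 2 + 625) ^ 2 + (-(115200 : ℝ) * t ^ 2 + 612000 * t + 540000) / (272 * t ^ 2 + 320 * t + 425) ^ 2) → ∀ (t : ℝ) (x : EuclideanSpace ℝ (Fin 3)), x = !₂[(1 : ℝ), (0 : ℝ), ((-10) : ℝ)] + t • !₂[(0 : ℝ), (4 / 5 : ℝ), (3 / 5 : ℝ)] → HasDerivAt (fun s : ℝ => inner ℝ ((1 / 2 : ℝ) • (x + s • !₂[(1 : ℝ), (0 : ℝ), (0 : ℝ)]) - (-1 : ℝ) • Literature.Analysis.FluidPDE.cross (EuclideanSpace.single (2 : Fin 3) (1 : ℝ)) (x + s •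 !₂[(1 : ℝ), (0 : ℝ), (0 : ℝ)]) + ((8 : ℝ) / (‖(x + s • !₂[(1 : ℝ), (0 : ℝ), (0 : ℝ)]) - !₂[(0 : ℝ), (1 : ℝ), ((-10) : ℝ)]‖ ^ 2 - (inner ℝ ((x + s • !₂[(1 : ℝ), (0 : ℝ), (0 : ℝ)]) - !₂[(0 : ℝ), (1 : ℝ), ((-10) : ℝ)]) !₂[(-(4 / 5 : ℝ)), (0 : ℝ), (3 / 5 : ℝ)]) ^ 2)) • Literature.Analysis.FluidPDE.cross !₂[(-(4 / 5 : ℝ)), (0 : ℝ), (3 / 5 : ℝ)] ((x + s • !₂[(1 : ℝ), (0 : ℝ), (0 : ℝ)]) - !₂[(0 : ℝ), (1 : ℝ), ((-10) : ℝ)]) + ((8 : ℝ) / (‖(x + s • !₂[(1 : ℝ), (0 : ℝ), (0 : ℝ)]) - !₂[((-1) : ℝ), (0 : ℝ), ((-10) : ℝ)]‖ ^ 2 - (inner ℝ ((x + s • !₂[(1 : ℝ), (0 : ℝ), (0 : ℝ)]) - !₂[((-1) : ℝ), (0 : ℝ), ((-10) : ℝ)]) !₂[(0 : ℝ), (-(4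 / 5 : ℝ)), (3 / 5 : ℝ)]) ^ 2)) • Literature.Analysis.FluidPDE.cross !₂[(0 : ℝ), (-(4 / 5 : ℝ)), (3 / 5 : ℝ)] ((x + s • !₂[(1 : ℝ), (0 : ℝ), (0 : ℝ)]) - !₂[((-1) : ℝ), (0 : ℝ), ((-10) : ℝ)]) + ((8 : ℝ) / (‖(x + s • !₂[(1 : ℝ), (0 : ℝ), (0 : ℝ)]) - !₂[(0 : ℝ), ((-1) : ℝ), ((-10) : ℝ)]‖ ^ 2 - (inner ℝ ((x + s • !₂[(1 : ℝ), (0 : ℝ), (0 : ℝ)]) - !₂[(0 : ℝ), ((-1) : ℝ), ((-10) : ℝ)]) !₂[(4 / 5 : ℝ), (0 : ℝ), (3 / 5 : ℝ)]) ^ 2)) • Literature.Analysis.FluidPDE.cross !₂[(4 / 5 : ℝ), (0 : ℝ), (3 / 5 : ℝ)] ((x + s • !₂[(1 : ℝ), (0 : ℝ), (0 : ℝ)]) - !₂[(0 : ℝ), ((-1) : ℝ), ((-10) : ℝ)])) !₂[(0 : ℝ), (3 / 5 : ℝ), (-(4 / 5 : ℝ))]) (Q t) 0 := by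
  intro Q hQ t x hx
  obtain ⟨hp₁, hp₂, hp₃⟩ := sbo_denoms_pos t
  obtain ⟨hD₁, hD₂, hD₃⟩ := sbo_datum_denoms t x hx
  obtain ⟨⟨hβ₁, hc₁, hκ₁⟩, ⟨hβ₂, hc₂, hκ₂⟩, ⟨hβ₃, hc₃, hκ₃⟩⟩ := sbo_datum12_lines t x hx
  obtain ⟨hvw, hrot⟩ := sbo_datum12_drift
  refine (sbo_hasDerivAt_link x _ _ _ _ _ _ _ _ _ (-1 : ℝ) 8 ?_ ?_ ?_).congr_deriv ?_
  · rw [hD₁]; exact div_ne_zero (mul_ne_zero two_ne_zero hp₁.ne') (by norm_num)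
  · rw [hD₂]; positivity
  · rw [hD₃]; exact div_ne_zero (mul_ne_zero two_ne_zero hp₃.ne') (by norm_num)
  · rw [hQ, hD₁, hD₂, hD₃, hβ₁, hβ₂, hβ₃, hc₁, hc₂, hc₃, hκ₁, hκ₂, hκ₃, hvw, hrot]
    have hq₁ := hp₁.ne'
    have hq₂ := hp₂.ne'
    have hq₃ := hp₃.ne'
    field_simp
    ring

/-- Entry `(2,1)` of the transverse linearisation block: probe `n₂`, component `n₁`. [folklore] -/
private theorem sbo_entry21 : ∀ (Q : ℝ → ℝ), (∀ t, Q t = -(3 / 5) + (-(115200 : ℝ) * t ^ 2 - 612000 * t + 540000) / (272 * t ^ 2 - 320 * t + 425) ^ 2 + ((218750 : ℝ) - 50400 * t ^ 2) / (144 * t ^ 2 + 625) ^ 2 + (-(115200 : ℝ) * t ^ 2 + 612000 * t + 540000) / (272 * t ^ 2 + 320 * t + 425) ^ 2) → ∀ (t : ℝ) (x : EuclideanSpace ℝ (Fin 3)), x = !₂[(1 : ℝ), (0 : ℝ), ((-10) : ℝ)] + t • !₂[(0 : ℝ), (4 / 5 : ℝ), (3 / 5 : ℝ)] → HasDerivAt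 (fun s : ℝ => inner ℝ ((1 / 2 : ℝ) • (x + s • !₂[(0 : ℝ), (3 / 5 : ℝ), (-(4 / 5 : ℝ))]) - (-1 : ℝ) • Literature.Analysis.FluidPDE.cross (EuclideanSpace.single (2 : Fin 3) (1 : ℝ)) (x + s • !₂[(0 : ℝ), (3 / 5 : ℝ), (-(4 / 5 : ℝ))]) + ((8 : ℝ) / (‖(x + s • !₂[(0 : ℝ), (3 / 5 : ℝ), (-(4 / 5 : ℝ))]) - !₂[(0 : ℝ), (1 : ℝ), ((-10) : ℝ)]‖ ^ 2 - (inner ℝ ((x + s • !₂[(0 : ℝ), (3 / 5 : ℝ), (-(4 / 5 : ℝ))]) - !₂[(0 : ℝ), (1 : ℝ), ((-10) : ℝ)]) !₂[(-(4 / 5 : ℝ)), (0 : ℝ), (3 / 5 : ℝ)]) ^ 2)) • Literature.Analysis.FluidPDE.cross !₂[(-(4 / 5 : ℝ)), (0 : ℝ), (3 / 5 : ℝ)] ((x + s • !₂[(0 : ℝ), (3 / 5 : ℝ), (-(4 / 5 : ℝ))]) - !₂[(0 : ℝ), (1 : ℝ), ((-10) : ℝ)]) + ((8 : ℝ) / (‖(x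 + s • !₂[(0 : ℝ), (3 / 5 : ℝ), (-(4 / 5 : ℝ))]) - !₂[((-1) : ℝ), (0 : ℝ), ((-10) : ℝ)]‖ ^ 2 - (inner ℝ ((x + s • !₂[(0 : ℝ), (3 / 5 : ℝ), (-(4 / 5 : ℝ))]) - !₂[((-1) : ℝ), (0 : ℝ), ((-10) : ℝ)]) !₂[(0 : ℝ), (-(4 / 5 : ℝ)), (3 / 5 : ℝ)]) ^ 2)) • Literature.Analysis.FluidPDE.cross !₂[(0 : ℝ), (-(4 / 5 : ℝ)), (3 / 5 : ℝ)] ((x + s • !₂[(0 : ℝ), (3 / 5 : ℝ), (-(4 / 5 : ℝ))]) - !₂[((-1) : ℝ), (0 : ℝ), ((-10) : ℝ)]) + ((8 : ℝ) / (‖(x + s • !₂[(0 : ℝ), (3 / 5 : ℝ), (-(4 / 5 : ℝ))]) - !₂[(0 : ℝ), ((-1) : ℝ), ((-10) : ℝ)]‖ ^ 2 - (inner ℝ ((x + s • !₂[(0 : ℝ), (3 / 5 : ℝ), (-(4 / 5 : ℝ))]) - !₂[(0 : ℝ), ((-1) : ℝ), ((-10) : ℝ)]) !₂[(4 / 5 :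 ℝ), (0 : ℝ), (3 / 5 : ℝ)]) ^ 2)) • Literature.Analysis.FluidPDE.cross !₂[(4 / 5 : ℝ), (0 : ℝ), (3 / 5 : ℝ)] ((x + s • !₂[(0 : ℝ), (3 / 5 : ℝ), (-(4 / 5 : ℝ))]) - !₂[(0 : ℝ), ((-1) : ℝ), ((-10) : ℝ)])) !₂[(1 : ℝ), (0 : ℝ), (0 : ℝ)]) (Q t) 0 := by
  intro Q hQ t x hx
  obtain ⟨hp₁, hp₂, hp₃⟩ := sbo_denoms_pos t
  obtain ⟨hD₁, hD₂, hD₃⟩ := sbo_datum_denoms t x hx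
  obtain ⟨⟨hβ₁, hc₁, hκ₁⟩, ⟨hβ₂, hc₂, hκ₂⟩, ⟨hβ₃, hc₃, hκ₃⟩⟩ := sbo_datum21_lines t x hx
  obtain ⟨hvw, hrot⟩ := sbo_datum21_drift
  refine (sbo_hasDerivAt_link x _ _ _ _ _ _ _ _ _ (-1 : ℝ) 8 ?_ ?_ ?_).congr_deriv ?_
  · rw [hD₁]; exact div_ne_zero (mul_ne_zero two_ne_zero hp₁.ne') (by norm_num)
  · rw [hD₂]; positivity
  · rw [hD₃]; exact div_ne_zero (mul_ne_zero two_ne_zero hp₃.ne') (by norm_num)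
  · rw [hQ, hD₁, hD₂, hD₃, hβ₁, hβ₂, hβ₃, hc₁, hc₂, hc₃, hκ₁, hκ₂, hκ₃, hvw, hrot]
    have hq₁ := hp₁.ne'
    have hq₂ := hp₂.ne'
    have hq₃ := hp₃.ne'
    field_simp
    ring

/-- **Transverse linearisation block, off-diagonal entries (re-keyed datum `α = −1`).** For the
crux's C₄ skew-line datum (stmt-NavierStokesRegularity-15400, line `Sketch`: `P₀ = (1,0,−10)`,
`e₀ = (0,4/5,3/5)`, `γ/2π = 8`, `α = −1`), along the core line `x = P₀ + t e₀` and in the unit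
transverse basis `n₁ = (1,0,0)`, `n₂ = e₀ × n₁ = (0,3/5,−4/5)`, the off-diagonal entries of the
linearisation of the inner skeleton field (Leray–rotation drift `½ y + e₃ × y` plus the
straight-line Biot–Savart induction of the three image lines),
`Q₁₂(t) = d/ds ⟪F(x + s n₁), n₂⟫|₀` and `Q₂₁(t) = d/ds ⟪F(x + s n₂), n₁⟫|₀`, are the stated closed
forms (`Q₁₂ − Q₂₁ = 2 · (−α)⟪e₃, n₁ × n₂⟫ = 2 · 3/5`: the antisymmetric part is the frame rotation,
the image strain being symmetric). [folklore] -/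
theorem stub_strainBlockOffDiagA1 : (∀ (Q : ℝ → ℝ), (∀ t, Q t = 3 / 5 + (-(115200 : ℝ) * t ^ 2 - 612000 * t + 540000) / (272 * t ^ 2 - 320 * t + 425) ^ 2 + ((218750 : ℝ) - 50400 * t ^ 2) / (144 * t ^ 2 + 625) ^ 2 + (-(115200 : ℝ) * t ^ 2 + 612000 * t + 540000) / (272 * t ^ 2 + 320 * t + 425) ^ 2) → ∀ (t : ℝ) (x : EuclideanSpace ℝ (Fin 3)), x = !₂[(1 : ℝ), (0 : ℝ), ((-10) : ℝ)] + t • !₂[(0 : ℝ), (4 / 5 : ℝ), (3 / 5 : ℝ)] → HasDerivAt (fun s : ℝ => inner ℝ ((1 / 2 : ℝ) • (x + s • !₂[(1 : ℝ), (0 : ℝ), (0 : ℝ)]) - (-1 : ℝ) • Literature.Analysis.FluidPDE.cross (EuclideanSpace.single (2 : Fin 3) (1 : ℝ)) (x + s • !₂[(1 : ℝ), (0 : ℝ), (0 : ℝ)]) + ((8 : ℝ) / (‖(x + s • !₂[(1 : ℝ), (0 : ℝ), (0 : ℝ)]) - !₂[(0 : ℝ), (1 : ℝ), ((-10) : ℝ)]‖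 ^ 2 - (inner ℝ ((x + s • !₂[(1 : ℝ), (0 : ℝ), (0 : ℝ)]) - !₂[(0 : ℝ), (1 : ℝ), ((-10) : ℝ)]) !₂[(-(4 / 5 : ℝ)), (0 : ℝ), (3 / 5 : ℝ)]) ^ 2)) • Literature.Analysis.FluidPDE.cross !₂[(-(4 / 5 : ℝ)), (0 : ℝ), (3 / 5 : ℝ)] ((x + s • !₂[(1 : ℝ), (0 : ℝ), (0 : ℝ)]) - !₂[(0 : ℝ), (1 : ℝ), ((-10) : ℝ)]) + ((8 : ℝ) / (‖(x + s • !₂[(1 : ℝ), (0 : ℝ), (0 : ℝ)]) - !₂[((-1) : ℝ), (0 : ℝ), ((-10) : ℝ)]‖ ^ 2 - (inner ℝ ((x + s • !₂[(1 : ℝ), (0 : ℝ), (0 : ℝ)]) - !₂[((-1) : ℝ), (0 : ℝ), ((-10) : ℝ)]) !₂[(0 : ℝ), (-(4 / 5 : ℝ)), (3 / 5 : ℝ)]) ^ 2)) • Literature.Analysis.FluidPDE.cross !₂[(0 : ℝ), (-(4 / 5 : ℝ)), (3 / 5 : ℝ)] ((x + s • !₂[(1 : ℝ), (0 : ℝ),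 (0 : ℝ)]) - !₂[((-1) : ℝ), (0 : ℝ), ((-10) : ℝ)]) + ((8 : ℝ) / (‖(x + s • !₂[(1 : ℝ), (0 : ℝ), (0 : ℝ)]) - !₂[(0 : ℝ), ((-1) : ℝ), ((-10) : ℝ)]‖ ^ 2 - (inner ℝ ((x + s • !₂[(1 : ℝ), (0 : ℝ), (0 : ℝ)]) - !₂[(0 : ℝ), ((-1) : ℝ), ((-10) : ℝ)]) !₂[(4 / 5 : ℝ), (0 : ℝ), (3 / 5 : ℝ)]) ^ 2)) • Literature.Analysis.FluidPDE.cross !₂[(4 / 5 : ℝ), (0 : ℝ), (3 / 5 : ℝ)] ((x + s • !₂[(1 : ℝ), (0 : ℝ), (0 : ℝ)]) - !₂[(0 : ℝ), ((-1) : ℝ), ((-10) : ℝ)])) !₂[(0 : ℝ), (3 / 5 : ℝ), (-(4 / 5 : ℝ))]) (Q t) 0) ∧ (∀ (Q : ℝ → ℝ), (∀ t, Q t = -(3 / 5) + (-(115200 : ℝ) * t ^ 2 - 612000 * t + 540000) / (272 * t ^ 2 - 320 * t + 425) ^ 2 + ((218750 : ℝ) - 50400 * t ^ 2) / (144 * t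 ^ 2 + 625) ^ 2 + (-(115200 : ℝ) * t ^ 2 + 612000 * t + 540000) / (272 * t ^ 2 + 320 * t + 425) ^ 2) → ∀ (t : ℝ) (x : EuclideanSpace ℝ (Fin 3)), x = !₂[(1 : ℝ), (0 : ℝ), ((-10) : ℝ)] + t • !₂[(0 : ℝ), (4 / 5 : ℝ), (3 / 5 : ℝ)] → HasDerivAt (fun s : ℝ => inner ℝ ((1 / 2 : ℝ) • (x + s • !₂[(0 : ℝ), (3 / 5 : ℝ), (-(4 / 5 : ℝ))]) - (-1 : ℝ) • Literature.Analysis.FluidPDE.cross (EuclideanSpace.single (2 : Fin 3) (1 : ℝ)) (x + s • !₂[(0 : ℝ), (3 / 5 : ℝ), (-(4 / 5 : ℝ))]) + ((8 : ℝ) / (‖(x + s • !₂[(0 : ℝ), (3 / 5 : ℝ), (-(4 / 5 : ℝ))]) - !₂[(0 : ℝ), (1 : ℝ), ((-10) : ℝ)]‖ ^ 2 - (inner ℝ ((x + s • !₂[(0 : ℝ), (3 / 5 : ℝ), (-(4 / 5 : ℝ))]) - !₂[(0 : ℝ), (1 : ℝ), ((-10) : ℝ)]) !₂[(-(4 / 5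 : ℝ)), (0 : ℝ), (3 / 5 : ℝ)]) ^ 2)) • Literature.Analysis.FluidPDE.cross !₂[(-(4 / 5 : ℝ)), (0 : ℝ), (3 / 5 : ℝ)] ((x + s • !₂[(0 : ℝ), (3 / 5 : ℝ), (-(4 / 5 : ℝ))]) - !₂[(0 : ℝ), (1 : ℝ), ((-10) : ℝ)]) + ((8 : ℝ) / (‖(x + s • !₂[(0 : ℝ), (3 / 5 : ℝ), (-(4 / 5 : ℝ))]) - !₂[((-1) : ℝ), (0 : ℝ), ((-10) : ℝ)]‖ ^ 2 - (inner ℝ ((x + s • !₂[(0 : ℝ), (3 / 5 : ℝ), (-(4 / 5 : ℝ))]) - !₂[((-1) : ℝ), (0 : ℝ), ((-10) : ℝ)]) !₂[(0 : ℝ), (-(4 / 5 : ℝ)), (3 / 5 : ℝ)]) ^ 2)) • Literature.Analysis.FluidPDE.cross !₂[(0 : ℝ), (-(4 / 5 : ℝ)), (3 / 5 : ℝ)] ((x + s • !₂[(0 : ℝ), (3 / 5 : ℝ), (-(4 / 5 : ℝ))]) - !₂[((-1) : ℝ), (0 : ℝ), ((-10) : ℝ)]) + ((8 : ℝ) / (‖(x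 + s • !₂[(0 : ℝ), (3 / 5 : ℝ), (-(4 / 5 : ℝ))]) - !₂[(0 : ℝ), ((-1) : ℝ), ((-10) : ℝ)]‖ ^ 2 - (inner ℝ ((x + s • !₂[(0 : ℝ), (3 / 5 : ℝ), (-(4 / 5 : ℝ))]) - !₂[(0 : ℝ), ((-1) : ℝ), ((-10) : ℝ)]) !₂[(4 / 5 : ℝ), (0 : ℝ), (3 / 5 : ℝ)]) ^ 2)) • Literature.Analysis.FluidPDE.cross !₂[(4 / 5 : ℝ), (0 : ℝ), (3 / 5 : ℝ)] ((x + s • !₂[(0 : ℝ), (3 / 5 : ℝ), (-(4 / 5 : ℝ))]) - !₂[(0 : ℝ), ((-1) : ℝ), ((-10) : ℝ)])) !₂[(1 : ℝ), (0 : ℝ), (0 : ℝ)]) (Q t) 0) := by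
  exact ⟨sbo_entry12, sbo_entry21⟩

end

end Summit.NavierStokesRegularity.NavierStokesRegularity.Theorems.SkeletonEquilibrium.Sketch
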